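import Mathlib
import Literature.Computability.AlgebraicComplexity.NestFreeMatchingPoly
import Literature.Computability.AlgebraicComplexity.MonotoneCircuitNewtonPolytopeXC
import Literature.Algebra.Polynomial.NewtonPolytope
import Literature.Barriers.PneNP.ExtendedFormulationMinkowskiFaces
import Literature.Barriers.PneNP.TSPExtensionComplexityFactorization
import Literature.Barriers.PneNP.CorrelationPolytopeXCLowerBoundGraph
import Literature.Combinatorics.Optimization.CorrelationPolytopeGridMinor
import Summits.ValiantsHypothesis.ValiantsHypothesis.Theses.FifoMatching
import Summits.ValiantsHypothesis.ValiantsHypothesis.Theorems.FifoMatchingXcMinkowskiMultiplesHard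
import Summits.ValiantsHypothesis.ValiantsHypothesis.Theorems.FifoMatchingXcDivisionZmixFace
import HarnessLib

/-!
# val-idea-40 g0 (b124 WAVE-4, lens «Minkowski-summand structure — which Q survive») — Sketch for TWO crux idea cards
# on stmt-ValiantsHypothesis-21181 `FifoMatching.NNDivisionHard` (residual COR-MINKOWSKI)

§B  CARD `vxc-charged-passenger`: the crux CHARGES `L₊(h)`, hence it already follows from the VIRTUAL extension
    complexity law `VxcMinkowskiHard` (Hertrich–Loho 2024 `vxc`, exact dictionary: their DIFFERENCE `P = R − Q` is our
    SUM `R = NFP_n + Newt h`), strictly weaker than the `XcMinkowskiHard` of record (p625002 drops the `+ L₊(h)`).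
    PROVED here: `nnDivisionHard_of_vxcMinkowski` (kernel lemma, concludes the crux BY NAME),
    `vxcMinkowskiHard_of_xcMinkowskiHard`, `corVxcHard_of_corMinkowskiHard`, the pair face/image transport
    `vxc_transport_step`; STATED: `CorVxcHard` (COR currency), `VxcTransport` (mirror of the PROVED `xcTransport_holds`).
§A  CARD `flag-exposure-dimension-rung`: the unified CONE CERTIFICATE (PROVED: `cone_certificate` — rows valid for `P`
    maximised over `Q` at ONE point `q₀` ⇒ the slack of `P + Q` at columns `v_b + q₀` IS the slack of `P`; PROP A♯ /
    FMPTW are the clique-row instances) and the STATED dimension rung `DimensionRung`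
    (`xc(COR_h + Q) ≥ 1.5^{h − dim Q} − 1` for EVERY passenger, by generic exposure along coordinate flags), with its
    two typed ingredients `exposure_exists` (PROVED) and `coordFaceDir_inter_trivial` (STATED).
Nothing here is a theorem about the summit; VP ≠ VNP is NOT proved; 21181 stays OPEN.
-/

set_option autoImplicit false
set_option linter.dupNamespace false

namespace Summit.ValiantsHypothesis.ValiantsHypothesis.Cruxes.NNDivisionHard.ValIdea40

open scoped NNReal Pointwise
open MvPolynomial
open Literature.Computability.AlgebraicComplexity (complexity nestFreeMatchingPoly)
open Literature.Computability.AlgebraicComplexity.MonotoneCircuitEF (hasEFOfSize_newtonPolytope_complexity)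
open Literature.Algebra.Polynomial.NewtonPolytope (newtonPolytope newtonPolytope_mul)
open Literature.Barriers.PneNP (HasEFOfSize)
open Literature.Combinatorics.Optimization (corVec corPolytopeGraph)
open Summit.ValiantsHypothesis.ValiantsHypothesis.Theorems.FifoMatching.XcDivision
  (hasEFOfSize_minkowski_of_complexity_le)

/-- the route threshold `T(c,n) = 2^((log₂ n + c)^c)` (super-quasi-polynomial scale). -/
abbrev T (c n : ℕ) : ℕ := 2 ^ ((Nat.log 2 n + c) ^ c)

/-- the REAL Newton polytope of a polynomial over `ℝ≥0`. -/
abbrev newtR {σ : Type} (f : MvPolynomial σ ℝ≥0) : Set (σ → ℝ) :=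
  newtonPolytope (MvPolynomial.map NNReal.toRealHom f)

/-! ## §B  CHARGE THE PASSENGER: the virtual-extension-complexity dictionary -/

/-- **VXC-MINKOWSKI (NFP currency).**  Eventually in `n`, NO nonzero cofactor `h` has BOTH `NFP_n + Newt(h)` and `Newt(h)`
with extended formulations of size `≤ 3·T(c,n)`.  In Hertrich–Loho's language (arXiv:2411.03006, Def. p.3): the virtual
extension complexity of `NFP_n` RESTRICTED to co-summands that are Newton polytopes of `ℝ≥0`-polynomials is super-quasi-polynomial
(`NFP_n = R − Q` formally with `R = NFP_n + Newt h`, `Q = Newt h`). Strictly weaker than `XcMinkowskiHard` (which forbids the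
first conjunct alone). -/
def VxcMinkowskiHard : Prop :=
  ∀ c : ℕ, ∃ n₀ : ℕ, ∀ n ≥ n₀, ∀ h : MvPolynomial (Fin (2 * n) × Fin (2 * n)) ℝ≥0, h ≠ 0 →
    ¬ (HasEFOfSize (newtR (nestFreeMatchingPoly n ℝ≥0) + newtR h) (3 * T c n) ∧ HasEFOfSize (newtR h) (3 * T c n))

/-- XC-MINKOWSKI (the hypothesis of p625002 `nnDivisionHard_of_xcMinkowski`, verbatim shape) ⇒ VXC-MINKOWSKI. -/
theorem vxcMinkowskiHard_of_xcMinkowskiHard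
    (hX : ∀ c : ℕ, ∃ n₀ : ℕ, ∀ n ≥ n₀, ∀ h : MvPolynomial (Fin (2 * n) × Fin (2 * n)) ℝ≥0, h ≠ 0 →
      ¬ HasEFOfSize (newtR (nestFreeMatchingPoly n ℝ≥0) + newtR h) (3 * T c n)) :
    VxcMinkowskiHard := by
  intro c
  obtain ⟨n₀, hn₀⟩ := hX c
  exact ⟨n₀, fun n hn h hh hboth => hn₀ n hn h hh hboth.1⟩

/-- ★ **KERNEL LEMMA (card B): VXC-MINKOWSKI ⇒ stmt-21181 `NNDivisionHard`, BY NAME.**  The crux charges `L₊(NN_n·h) + L₊(h)`;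
if that sum is `≤ T` then `xc(NFP_n + Newt h) ≤ 3·L₊(NN_n h) ≤ 3T` (`newtonPolytope_mul` + Hrubeš–Yehudayoff Thm 35, in the tree as
`hasEFOfSize_minkowski_of_complexity_le`) AND `xc(Newt h) ≤ 3·L₊(h) ≤ 3T` (`hasEFOfSize_newtonPolytope_complexity`). -/
theorem nnDivisionHard_of_vxcMinkowski (hV : VxcMinkowskiHard) :
    Summit.ValiantsHypothesis.ValiantsHypothesis.Theses.FifoMatching.NNDivisionHard := by
  intro c
  obtain ⟨n₀, hn₀⟩ := hV c
  refine ⟨n₀, fun n hn h hh => ?_⟩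
  by_contra hle
  push Not at hle
  have hle' : complexity (nestFreeMatchingPoly n ℝ≥0 * h) + complexity h ≤ T c n := hle
  refine hn₀ n hn h hh ⟨hasEFOfSize_minkowski_of_complexity_le n h (by omega), ?_⟩
  exact (hasEFOfSize_newtonPolytope_complexity h).of_le (by omega)

/-- **COR-VXC (COR currency, card B's proposed crux K_v):** eventually in `h`, for every finite point family `q` whose hull has an
extended formulation of size `r`, an extended formulation of `COR(K_h) + conv q` of size `r` forces `T(c,h) < r`.  (The
`CorMinkowskiHard` of `Lines/xc_division.lean` is the same statement WITHOUT the hypothesis on `conv q`.) -/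
def CorVxcHard : Prop :=
  ∀ c : ℕ, ∃ h₀ : ℕ, ∀ h ≥ h₀, ∀ (K : ℕ) (q : Fin (K + 1) → (Fin h × Fin h → ℝ)) (r : ℕ),
    HasEFOfSize (convexHull ℝ (Set.range q)) r →
    HasEFOfSize (corPolytopeGraph (⊤ : SimpleGraph (Fin h)) + convexHull ℝ (Set.range q)) r → T c h < r

/-- COR-MINKOWSKI (verbatim shape of `XcDivision.CorMinkowskiHard`) ⇒ COR-VXC. -/
theorem corVxcHard_of_corMinkowskiHard
    (hK : ∀ c : ℕ, ∃ h₀ : ℕ, ∀ h ≥ h₀, ∀ (K : ℕ) (q : Fin (K + 1) → (Fin h × Fin h → ℝ)) (r : ℕ),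
      HasEFOfSize (corPolytopeGraph (⊤ : SimpleGraph (Fin h)) + convexHull ℝ (Set.range q)) r → T c h < r) :
    CorVxcHard := by
  intro c
  obtain ⟨h₀, hh₀⟩ := hK c
  exact ⟨h₀, fun h hh K q r _ hR => hh₀ h hh K q r hR⟩

/-- **The pair transport step (PROVED): `vxc` data survive located faces and linear images with no loss.**  From an EF of
`P + R` of size `r` and an EF of `R` of size `r'`, one valid functional `c` and any linear map `π` give EFs of
`π(F_c P) + π(F_c R)` of size `r` and of `π(F_c R)` of size `r'` — the two conjuncts of the VXC law move TOGETHER along the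
K1 face chain (`transport_geometric`), which is why `VxcTransport` below is expected to be proved exactly like `xcTransport_holds`.
[Schneider 1993 Thm 1.7.5(c); FMPTW Lemma 9] -/
theorem vxc_transport_step {ι : Type} [Fintype ι] {P R : Set (ι → ℝ)} {r r' : ℕ}
    (hPR : HasEFOfSize (P + R) r) (hR : HasEFOfSize R r') (c : ι → ℝ) (δ δ' : ℝ)
    (hP : ∀ x ∈ P, c ⬝ᵥ x ≤ δ) (hRv : ∀ y ∈ R, c ⬝ᵥ y ≤ δ')
    {κ : Type} [Fintype κ] (π : (ι → ℝ) →ₗ[ℝ] (κ → ℝ)) :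
    HasEFOfSize (π '' (P ∩ {x | c ⬝ᵥ x = δ}) + π '' (R ∩ {y | c ⬝ᵥ y = δ'})) r ∧
      HasEFOfSize (π '' (R ∩ {y | c ⬝ᵥ y = δ'})) r' :=
  ⟨hPR.image_face_add_image_face₁ c δ δ' hP hRv π, (hR.inter_eq c δ').image_linearMap π⟩

/-- **VXC TRANSPORT (card B, stub of record — the mirror of the PROVED `XcDivision.xcTransport_holds`):** COR-VXC ⇒ VXC-MINKOWSKI,
by re-running `transport_geometric` with the passenger's own EF carried along via `vxc_transport_step`. -/
def VxcTransport : Prop := CorVxcHard → VxcMinkowskiHard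

/-- the card-B chain to the crux BY NAME: `VxcTransport → CorVxcHard → NNDivisionHard`. -/
theorem route_21181_of_corVxc (hT : VxcTransport) (hK : CorVxcHard) :
    Summit.ValiantsHypothesis.ValiantsHypothesis.Theses.FifoMatching.NNDivisionHard :=
  nnDivisionHard_of_vxcMinkowski (hT hK)

/-! ## §A  THE CONE CERTIFICATE and the DIMENSION RUNG (generic exposure along coordinate flags) -/

/-- ★ **CONE CERTIFICATE (PROVED; card A's first lemma).**  Let `P + Q` have an EF of size `r`.  If the rows `c_a·x ≤ d_a` are
valid for `P` and ONE point `q₀ ∈ Q` maximises every `c_a` over `Q` (all rows lie in one closed normal cone of `Q`), then for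
any columns `v_b ∈ P` the slack matrix `d_a − c_a·v_b` of `P` ITSELF has a nonnegative factorisation with `r + 1` terms — the
passenger is invisible.  PROP A♯ (`corPolytope_add_three_pow_le_of_common`, clique rows) and FMPTW (`Q` a point) are instances;
the dimension rung iterates it along faces. [Yannakakis; Rothvoß arXiv:1311.2369 Thm 4] -/
theorem cone_certificate {ι : Type} [Fintype ι] {P Q : Set (ι → ℝ)} {r : ℕ}
    (h : HasEFOfSize (P + Q) r) {q₀ : ι → ℝ} (hq₀ : q₀ ∈ Q)
    {A B : Type*} (c : A → ι → ℝ) (d : A → ℝ) (hvalid : ∀ a, ∀ x ∈ P, c a ⬝ᵥ x ≤ d a)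
    (hcone : ∀ a, ∀ y ∈ Q, c a ⬝ᵥ y ≤ c a ⬝ᵥ q₀) (v : B → ι → ℝ) (hv : ∀ b, v b ∈ P) :
    ∃ (U : A → Option (Fin r) → ℝ) (V : Option (Fin r) → B → ℝ),
      (∀ a l, 0 ≤ U a l) ∧ (∀ l b, 0 ≤ V l b) ∧
      ∀ a b, d a - c a ⬝ᵥ v b = ∑ l, U a l * V l b := by
  have hv' : ∀ b, v b + q₀ ∈ P + Q := fun b => Set.add_mem_add (hv b) hq₀
  have hvalid' : ∀ a, ∀ z ∈ P + Q, c a ⬝ᵥ z ≤ d a + c a ⬝ᵥ q₀ := by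
    intro a z hz
    obtain ⟨x, hx, y, hy, rfl⟩ := hz
    rw [dotProduct_add]
    exact add_le_add (hvalid a x hx) (hcone a y hy)
  obtain ⟨U, V, hU, hV, hUV⟩ :=
    h.exists_nonneg_factorisation (fun b => v b + q₀) hv' c (fun a => d a + c a ⬝ᵥ q₀) hvalid'
  refine ⟨U, V, hU, hV, fun a b => ?_⟩
  have := hUV a b
  simp only [dotProduct_add] at this
  linarith

/-- **EXPOSURE EXISTS (PROVED, elementary; card A's genericity step).**  If a finite point family `q` is NOT constant under some
generator `nv t` of a cone, then some STRICTLY POSITIVE combination of the generators is not constant on `q` either — so a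
generic direction in the (relatively open) normal cone of the current `COR`-face exposes a PROPER face of the passenger. -/
theorem exposure_exists {ι J Tgen : Type} [Fintype ι] [Fintype Tgen] [DecidableEq Tgen]
    (nv : Tgen → ι → ℝ) (q : J → ι → ℝ)
    {t₀ : Tgen} {j j' : J} (hne : nv t₀ ⬝ᵥ q j ≠ nv t₀ ⬝ᵥ q j') :
    ∃ μ : Tgen → ℝ, (∀ t, 0 < μ t) ∧
      ∃ i i' : J, (∑ t, μ t • nv t) ⬝ᵥ q i ≠ (∑ t, μ t • nv t) ⬝ᵥ q i' := by
  classical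
  by_contra hcon
  push Not at hcon
  -- with all weights 1 and with weight 2 on `t₀` the combination is constant on `q`; subtract.
  have h1 := hcon (fun _ => 1) (fun _ => one_pos) j j'
  have h2 := hcon (fun t => if t = t₀ then 2 else 1) (fun t => by split_ifs <;> norm_num) j j'
  have key : ∀ x : ι → ℝ, (∑ t, (if t = t₀ then (2 : ℝ) else 1) • nv t) ⬝ᵥ x =
      (∑ t, (1 : ℝ) • nv t) ⬝ᵥ x + nv t₀ ⬝ᵥ x := by
    intro x
    have hsplit : (∑ t, (if t = t₀ then (2 : ℝ) else 1) • nv t) = (∑ t, (1 : ℝ) • nv t) + nv t₀ := by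
      have : ∀ t, (if t = t₀ then (2 : ℝ) else 1) • nv t = (1 : ℝ) • nv t + (if t = t₀ then nv t else 0) := by
        intro t; split_ifs with ht <;> simp [two_smul]
      simp_rw [this, Finset.sum_add_distrib, Finset.sum_ite_eq', Finset.mem_univ, if_true]
    rw [hsplit, add_dotProduct]
  rw [key, key, h1] at h2
  exact hne (add_left_cancel h2)

/-- the direction space of the coordinate face `F_{A,B} = conv{bbᵀ : b ⊇ A, b ∩ B = ∅} ≅ COR(K_{h−|A∪B|})` of `COR(K_h)`
(ones prescribed on `A`, zeros on `B`). -/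
def coordFaceDir (h : ℕ) (A B : Finset (Fin h)) : Submodule ℝ (Fin h × Fin h → ℝ) :=
  vectorSpan ℝ ((corVec (⊤ : SimpleGraph (Fin h))) ''
    {b : Fin h → Bool | (∀ i ∈ A, b i = true) ∧ ∀ i ∈ B, b i = false})

/-- ★ **EXPOSURE RUNG (card A's proposed theorem, COR currency; ONE generic exposure).**  If no two generators of the passenger differ by a
direction of the coordinate face `F_{A,B}`, then a GENERIC functional in the relative interior of the normal cone of `F_{A,B}` exposes
`F_{A,B} + {point}` (`exposure_exists`: the normal cone spans `(lin F_{A,B})^⊥`, so it separates the finitely many generator differences), and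
FMPTW/Kaibel–Weltge on `F_{A,B} ≅ COR(K_{h−|A|−|B|})` gives `3^{h−|A|−|B|} ≤ (r+1)·2^{h−|A|−|B|}`.  PROP B of `xc_division.lean` is the instance
«direction `E_A − E_B`, count the maximisers»; here the direction is generic in the whole cone and the count is 1. -/
def ExposureRung : Prop :=
  ∀ (h K r : ℕ) (q : Fin (K + 1) → (Fin h × Fin h → ℝ)) (A B : Finset (Fin h)), Disjoint A B →
    (∀ j j', q j - q j' ∈ coordFaceDir h A B → q j = q j') →
    HasEFOfSize (corPolytopeGraph (⊤ : SimpleGraph (Fin h)) + convexHull ℝ (Set.range q)) r →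
      3 ^ (h - (A.card + B.card)) ≤ (r + 1) * 2 ^ (h - (A.card + B.card))

/-- **FLAG LEMMA (card A, stated; finite linear algebra):** the direction spaces of the one-step refinements `F_{A ∪ {j}, ∅}`, `j ∉ A`, of a
coordinate face have TRIVIAL common intersection (a direction in all of them has `D_pq = 0` on `(A∪{j})²` for every `j` and the row
coupling `D_jk = D_kk = 0`).  Consequence: for a `d`-dimensional passenger there is a flag `A_1 ⊂ … ⊂ A_d`, one index at a time, with
`vectorSpan Q ∩ lin F_{A_d} = 0`, so `ExposureRung` applies with `|A| ≤ d`, `B = ∅` — this is `DimensionRung`. -/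
def CoordFaceDirInterTrivial : Prop :=
  ∀ (h : ℕ) (A : Finset (Fin h)) (D : Fin h × Fin h → ℝ),
    A ≠ Finset.univ → (∀ j ∉ A, D ∈ coordFaceDir h (insert j A) ∅) → D = 0

/-- the transversality step of the flag, typed: a nonzero subspace meeting `lin F_{A,∅}` can be cut down by one more prescribed index. -/
def FlagStep : Prop :=
  ∀ (h : ℕ) (A : Finset (Fin h)) (V : Submodule ℝ (Fin h × Fin h → ℝ)),
    A ≠ Finset.univ → V ≠ ⊥ → ∃ j ∉ A, ¬ (V ≤ coordFaceDir h (insert j A) ∅)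

/-- `FlagStep` is immediate from the flag lemma. -/
theorem flagStep_of_interTrivial (hI : CoordFaceDirInterTrivial) : FlagStep := by
  intro h A V hA hV
  by_contra hcon
  push Not at hcon
  apply hV
  rw [Submodule.eq_bot_iff]
  intro D hD
  exact hI h A D hA (fun j hj => hcon j hj hD)

/-- ★ **DIMENSION RUNG (card A's headline, COR currency):** for EVERY passenger `Q = conv q` — no genericity, no vertex count, no sign
pattern — `xc(COR(K_h) + Q) ≥ 1.5^{h − dim Q} − 1`, i.e. `3^{h−d} ≤ (r+1)·2^{h−d}` with `d = dim (aff Q)`.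
Proof plan: `FlagStep` iterated `d` times inside `vectorSpan Q` + `ExposureRung` with `B = ∅`. -/
def DimensionRung : Prop :=
  ∀ (h K r : ℕ) (q : Fin (K + 1) → (Fin h × Fin h → ℝ)),
    HasEFOfSize (corPolytopeGraph (⊤ : SimpleGraph (Fin h)) + convexHull ℝ (Set.range q)) r →
      3 ^ (h - Module.finrank ℝ (vectorSpan ℝ (Set.range q))) ≤
        (r + 1) * 2 ^ (h - Module.finrank ℝ (vectorSpan ℝ (Set.range q)))

/-- the rung's base case `d = 0` (a point passenger) is FMPTW/Kaibel–Weltge up to a translation, in the tree: -/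
theorem dimensionRung_point (h r : ℕ) (q : Fin 1 → (Fin h × Fin h → ℝ))
    (hyp : HasEFOfSize (corPolytopeGraph (⊤ : SimpleGraph (Fin h)) + convexHull ℝ (Set.range q)) r) :
    3 ^ h ≤ (r + 1) * 2 ^ h := by
  have hrange : Set.range q = {q 0} := by
    ext x
    simp only [Set.mem_range, Set.mem_singleton_iff]
    constructor
    · rintro ⟨i, rfl⟩; rw [Subsingleton.elim i 0]
    · rintro rfl; exact ⟨0, rfl⟩
  rw [hrange, convexHull_singleton, Set.add_singleton] at hyp
  have h2 := hyp.image_add_const (-(q 0))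
  have hset : (fun x => x + -q 0) '' ((fun x => x + q 0) '' corPolytopeGraph (⊤ : SimpleGraph (Fin h))) =
      corPolytopeGraph (⊤ : SimpleGraph (Fin h)) := by
    rw [Set.image_image]
    simp
  rw [hset] at h2
  exact Literature.Barriers.PneNP.corPolytopeGraph_top_three_pow_le h2


/-! ### A.3 The flag lemma, kernel-checked -/

/-- Equational envelope of a coordinate-face direction space: every `D ∈ lin F_{A,B}` vanishes on `A × A` and has its `A`-rows
coupled to the diagonal (`D_{pk} = D_{kk}` for `p ∈ A`). -/
theorem coordFaceDir_prop {h : ℕ} (A B : Finset (Fin h)) {D : Fin h × Fin h → ℝ}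
    (hD : D ∈ coordFaceDir h A B) :
    (∀ p ∈ A, ∀ q ∈ A, D (p, q) = 0) ∧ (∀ p ∈ A, ∀ k, D (p, k) = D (k, k)) := by
  unfold coordFaceDir at hD
  rw [vectorSpan_def] at hD
  induction hD using Submodule.span_induction with
  | mem x hx =>
    obtain ⟨u, hu, v, hv, rfl⟩ := Set.mem_vsub.1 hx
    obtain ⟨b, hb, rfl⟩ := hu
    obtain ⟨b', hb', rfl⟩ := hv
    simp only [Set.mem_setOf_eq] at hb hb'
    refine ⟨fun p hp q hq => ?_, fun p hp k => ?_⟩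
    · simp only [vsub_eq_sub, Pi.sub_apply, _root_.Summit.ValiantsHypothesis.ValiantsHypothesis.Theorems.FifoMatching.XcDivision.corVec_top_apply, hb.1 p hp, hb.1 q hq, hb'.1 p hp, hb'.1 q hq]
      simp
    · simp only [vsub_eq_sub, Pi.sub_apply, _root_.Summit.ValiantsHypothesis.ValiantsHypothesis.Theorems.FifoMatching.XcDivision.corVec_top_apply, hb.1 p hp, hb'.1 p hp]
      cases b k <;> cases b' k <;> simp
  | zero => simp
  | add x y _ _ hx hy =>
    refine ⟨fun p hp q hq => ?_, fun p hp k => ?_⟩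
    · simp [Pi.add_apply, hx.1 p hp q hq, hy.1 p hp q hq]
    · simp [Pi.add_apply, hx.2 p hp k, hy.2 p hp k]
  | smul a x _ hx =>
    refine ⟨fun p hp q hq => ?_, fun p hp k => ?_⟩
    · simp [Pi.smul_apply, hx.1 p hp q hq]
    · simp [Pi.smul_apply, hx.2 p hp k]

/-- ★ **The FLAG LEMMA holds** (`CoordFaceDirInterTrivial`, PROVED): a direction lying in `lin F_{A ∪ {j}}` for every `j ∉ A` is zero. -/
theorem coordFaceDirInterTrivial_holds : CoordFaceDirInterTrivial := by
  intro h A D hA hD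
  obtain ⟨j₀, hj₀⟩ : ∃ j, j ∉ A := by
    by_contra hcon
    push Not at hcon
    exact hA (Finset.eq_univ_of_forall hcon)
  have key : ∀ j ∉ A, (∀ p ∈ insert j A, ∀ q ∈ insert j A, D (p, q) = 0) ∧
      (∀ p ∈ insert j A, ∀ k, D (p, k) = D (k, k)) := fun j hj => coordFaceDir_prop _ _ (hD j hj)
  funext pq
  obtain ⟨p, q⟩ := pq
  show D (p, q) = 0
  by_cases hp : p ∈ A
  · by_cases hq : q ∈ A
    · exact (key j₀ hj₀).1 p (Finset.mem_insert_of_mem hp) q (Finset.mem_insert_of_mem hq)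
    · exact (key q hq).1 p (Finset.mem_insert_of_mem hp) q (Finset.mem_insert_self q A)
  · by_cases hq : q ∈ A
    · exact (key p hp).1 p (Finset.mem_insert_self p A) q (Finset.mem_insert_of_mem hq)
    · rw [(key p hp).2 p (Finset.mem_insert_self p A) q]
      exact (key q hq).1 q (Finset.mem_insert_self q A) q (Finset.mem_insert_self q A)

/-- hence the flag step. -/
theorem flagStep_holds : FlagStep := flagStep_of_interTrivial coordFaceDirInterTrivial_holds


/-! ### A.4 `DimensionRung` from `ExposureRung`, kernel-checked (the flag iteration) -/

theorem coordFaceDir_mono {h : ℕ} {A A' : Finset (Fin h)} (hAA' : A ⊆ A') :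
    coordFaceDir h A' ∅ ≤ coordFaceDir h A ∅ := by
  unfold coordFaceDir
  refine vectorSpan_mono ℝ (Set.image_mono ?_)
  intro b hb
  simp only [Set.mem_setOf_eq] at hb ⊢
  exact ⟨fun i hi => hb.1 i (hAA' hi), by simp⟩

theorem coordFaceDir_univ (h : ℕ) : coordFaceDir h Finset.univ ∅ = ⊥ := by
  unfold coordFaceDir
  have hsub : (corVec (⊤ : SimpleGraph (Fin h))) ''
      {b : Fin h → Bool | (∀ i ∈ (Finset.univ : Finset (Fin h)), b i = true) ∧
        ∀ i ∈ (∅ : Finset (Fin h)), b i = false} ⊆ {corVec (⊤ : SimpleGraph (Fin h)) (fun _ => true)} := by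
    rintro _ ⟨b, hb, rfl⟩
    have hb' : b = fun _ => true := funext fun i => hb.1 i (Finset.mem_univ i)
    subst hb'
    exact Set.mem_singleton _
  exact le_bot_iff.1 ((vectorSpan_mono ℝ hsub).trans (vectorSpan_singleton ℝ _).le)

/-- the flag iteration: starting from `A`, at most `finrank (V ⊓ lin F_A)` more prescribed indices make `V` transversal. -/
theorem flag_iterate {h : ℕ} (V : Submodule ℝ (Fin h × Fin h → ℝ)) :
    ∀ (n : ℕ) (A : Finset (Fin h)), Module.finrank ℝ ↥(V ⊓ coordFaceDir h A ∅) ≤ n →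
      ∃ A' : Finset (Fin h), A'.card ≤ A.card + n ∧ V ⊓ coordFaceDir h A' ∅ = ⊥ := by
  intro n
  induction n with
  | zero =>
    intro A hA
    exact ⟨A, by simp, Submodule.finrank_eq_zero.1 (Nat.le_zero.1 hA)⟩
  | succ n ih =>
    intro A hA
    by_cases hbot : V ⊓ coordFaceDir h A ∅ = ⊥
    · exact ⟨A, by simp, hbot⟩
    · have hAu : A ≠ Finset.univ := by
        rintro rfl
        exact hbot (by rw [coordFaceDir_univ]; simp)
      obtain ⟨j, hj, hnot⟩ := flagStep_holds h A (V ⊓ coordFaceDir h A ∅) hAu hbot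
      have hle : V ⊓ coordFaceDir h (insert j A) ∅ ≤ V ⊓ coordFaceDir h A ∅ :=
        inf_le_inf_left _ (coordFaceDir_mono (Finset.subset_insert j A))
      have hlt : V ⊓ coordFaceDir h (insert j A) ∅ < V ⊓ coordFaceDir h A ∅ := by
        refine lt_of_le_of_ne hle ?_
        intro heq
        apply hnot
        rw [← heq]
        exact inf_le_right
      have hrank := Submodule.finrank_lt_finrank_of_lt hlt
      obtain ⟨A', hcard, hA'⟩ := ih (insert j A) (by omega)
      refine ⟨A', ?_, hA'⟩
      have := Finset.card_insert_le j A
      omega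

theorem three_two_descend {m m' R : ℕ} (hmm : m ≤ m') (H : 3 ^ m' ≤ R * 2 ^ m') :
    3 ^ m ≤ R * 2 ^ m := by
  obtain ⟨k, rfl⟩ := Nat.exists_eq_add_of_le hmm
  have h2 : 0 < 2 ^ k := by positivity
  have key : 3 ^ m * 2 ^ k ≤ R * 2 ^ m * 2 ^ k :=
    calc 3 ^ m * 2 ^ k ≤ 3 ^ m * 3 ^ k :=
          Nat.mul_le_mul_left _ (Nat.pow_le_pow_left (by norm_num) k)
      _ = 3 ^ (m + k) := (pow_add 3 m k).symm
      _ ≤ R * 2 ^ (m + k) := H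
      _ = R * 2 ^ m * 2 ^ k := by rw [pow_add, mul_assoc]
  exact Nat.le_of_mul_le_mul_right key h2

/-- ★ **`DimensionRung` follows from `ExposureRung`** (PROVED): the flag lemma supplies, inside the passenger's direction space, at most
`dim Q` prescribed indices after which no two vertices of `Q` differ by a face direction; one generic exposure does the rest. -/
theorem dimensionRung_of_exposureRung (hE : ExposureRung) : DimensionRung := by
  intro h K r q hEF
  obtain ⟨A', hcard, hA'⟩ := flag_iterate (vectorSpan ℝ (Set.range q))
    (Module.finrank ℝ ↥(vectorSpan ℝ (Set.range q))) ∅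
    (Submodule.finrank_mono inf_le_left)
  have hsep : ∀ j j', q j - q j' ∈ coordFaceDir h A' ∅ → q j = q j' := by
    intro j j' hmem
    have hV : q j - q j' ∈ vectorSpan ℝ (Set.range q) := by
      have := vsub_mem_vectorSpan ℝ (Set.mem_range_self (f := q) j) (Set.mem_range_self (f := q) j')
      rwa [vsub_eq_sub] at this
    have hmem' : q j - q j' ∈ vectorSpan ℝ (Set.range q) ⊓ coordFaceDir h A' ∅ := ⟨hV, hmem⟩
    rw [hA', Submodule.mem_bot] at hmem'
    exact sub_eq_zero.1 hmem'
  have hrung := hE h K r q A' ∅ (Finset.disjoint_empty_right A') hsep hEF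
  simp only [Finset.card_empty, add_zero] at hrung
  simp only [Finset.card_empty, zero_add] at hcard
  exact three_two_descend (by omega) hrung

end Summit.ValiantsHypothesis.ValiantsHypothesis.Cruxes.NNDivisionHard.ValIdea40
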